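import Literature.Analysis.InnerProduct.LensSpaceIsospectralRigidityPrime
import Literature.Analysis.InnerProduct.LensSpaceGeneratingFunctionDoublePoles
import HarnessLib

/-!
# Ikeda–Yamamoto's Main Theorem for an odd order `q` in the generic case `(p₁ + 1, q) = (p₁ − 1, q) = 1`: two isospectral
# three-dimensional lens spaces `L(q; 1, p₁)`, `L(q; 1, p₂)` are isometric (Ikeda–Yamamoto 1979, §7, first case)

Layer `Literature/Analysis/InnerProduct`, namespace `Literature.Analysis.InnerProduct`; lane `lit-hodgefound`, prover seat
`lit-hodgefound-p06`, generation 45, row g45-#5. THEOREMS only (no definition, no instance, no notation, no named fact).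
Companion of `LensSpaceIsospectralRigidityPrime.lean` (row g45-#2, `q` prime) and `LensSpaceGeneratingFunctionDoublePoles.lean`
(row g45-#3, Lemma 4.4 / Corollary 4.5).

## Source, verbatim (held text `paper:doi-10-18910-4811`)

A. Ikeda, Y. Yamamoto, *On the spectra of 3-dimensional lens spaces*, Osaka J. Math. **16** (1979) 447–469, §7 (p. 460): "**7. Proof
of Main Theorem for `q = l^ν` (`l` is an odd prime and `ν ≥ 2`).** In the case `(p₁ + 1, q) = (p₁ − 1, q) = 1`, we can prove
in the same way as in 6." — §6 (p. 459): "**Proof of Main Theorem for odd prime `q`.** … By Proposition 4.1, it is sufficient to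
show that either `p₁ ≡ ±p₂ (mod q)` or `p₁ ≡ ±p₂* (mod q)`. Substituting `k = 1` (which satisfies (4.13) and (4.14)) in the
formula (4.18), we have (6.2). … Applying Lemma 5.3 to (6.2) …" — §5 (p. 458): "**Lemma 5.3.** Let `q` be an ARBITRARY natural
number. Then the real numbers `cot(π/q)k` (`1 ≤ k < q/2`, `(k, q) = 1`) are linearly independent over `Q`." — §4 (p. 455–456):
"**Corollary 4.5.** … Let `k` be an integer such that (4.13) `(p₁ + 1)k ≢ 0 (mod q)` and (4.14) `(p₁ − 1)k ≢ 0 (mod q)`. Then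
we have (4.15) `(p₂ + 1)k ≢ 0 (mod q)` and (4.16) `(p₂ − 1)k ≢ 0 (mod q)`."

## What is proved, and how

The argument of §6 uses the primality of `q` at exactly one place: to know that the eight arguments `p₁ ± 1`, `p₁* ± 1`,
`p₂ ± 1`, `p₂* ± 1` of (6.2) are prime to `q`, so that Lemma 5.3 applies. Lemma 5.3 itself holds for every `q` (the tree's
theorem of Chowla–Okada, `okada_linearIndependent_cot_of_units`), and so does the combinatorial core of row g45-#2
(`eq_or_eq_neg_of_cot_relation`: for `q ≥ 3` odd, the multiplicity function of the class `{±p₁, ±p₁*}` is `2`-periodic on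
`ℤ/q`, hence constant). Hence, for ANY odd `q ≥ 3`: if `p₁ + 1` and `p₁ − 1` are prime to `q` — the hypothesis of the first
case of §7 — then so are `p₁* ± 1` (`p₁* + 1 ≡ p₁*(p₁ + 1)`, `p₁* − 1 ≡ −p₁*(p₁ − 1)`), and, for an isospectral `L(q; 1, p₂)`,
so are `p₂ ± 1` and `p₂* ± 1` — this is COROLLARY 4.5 in its divisor form (row g45-#3, `dvd_or_dvd_of_dvd_of_lensMultiplicity_eq`:
a common divisor `d > 1` of `p₂ ± 1` and `q` is odd, so `q ∤ 2(q/d)`, and it would divide `p₁ + 1` or `p₁ − 1`); then (4.18)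
with `k = 1` and the core give `p₂ ≡ ±p₁` or `p₁p₂ ≡ ±1 (mod q)`.

* §1: **`dvd_of_lensMultiplicity_one_eq_of_odd`** — THE MAIN THEOREM for odd `q ≥ 3`, normalized weights, under
  `(p₁ ± 1, q) = 1` (for `q = l^ν` this is the first case of §7; for `q = l` prime it is the generic case of §6).
* §2: **`dvd_of_lensMultiplicity_eq_of_odd`** — general weights `L(q; p₁, p₂)`, `L(q; p₁', p₂')` under `(p₁ ± p₂, q) = 1`
  (`L(q; p₁, p₂) ≅ L(q; 1, p₁*p₂)` and `p₁*p₂ ± 1 ≡ p₁*(p₂ ± p₁)`), and **`lensWeightsEquivalent_of_lensMultiplicity_eq_of_odd`**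
  — ISOSPECTRAL ⟹ ISOMETRIC (Ikeda's criterion, Proposition 1.1) in that case.

## References

* [IkedaYamamoto1979] A. Ikeda, Y. Yamamoto, *On the spectra of 3-dimensional lens spaces*, Osaka J. Math. 16 (1979) 447–469:
  Main Theorem, §7 (first case), §6, Lemma 5.3, Corollary 4.5, Corollary 4.7 (4.18), Proposition 4.1, Proposition 1.1.
* [Okada1981] T. Okada, *On an extension of a theorem of S. Chowla*, Acta Arith. 38 (1980/81) 341–345 (Lemma 5.3 for all `q`).
* [Ikeda1980] A. Ikeda, *On lens spaces which are isospectral but not isometric*, Ann. Sci. ÉNS (4) 13 (1980) 303–315,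
  Theorem 2.1 (the isometry criterion `LensWeightsEquivalent`).
-/

noncomputable section

open Finset Filter Topology Complex

namespace Literature.Analysis.InnerProduct

open _root_.Real _root_.Filter _root_.Topology

/-! ### §1 The normalized Main Theorem for odd `q` under `(p₁ ± 1, q) = 1` -/

/-- `cot(πt/q) = cot(πt̃/q)` with `t̃ ∈ [0, q)` the representative of `t mod q`. [folklore] -/
private theorem cot_intCast_eq_cot_val'' {q : ℕ} [NeZero q] (t : ℤ) :
    Complex.cot (π * t / q) = Complex.cot (π * (((t : ZMod q).val : ℕ) : ℂ) / q) := by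
  have hq : (q : ℂ) ≠ 0 := Nat.cast_ne_zero.mpr (NeZero.ne q)
  obtain ⟨m, hm⟩ : (q : ℤ) ∣ t - (((t : ZMod q).val : ℕ) : ℤ) := by
    rw [← ZMod.intCast_zmod_eq_zero_iff_dvd]
    push_cast
    rw [ZMod.natCast_zmod_val, sub_self]
  have he : cexp (2 * π * I * t / q) = cexp (2 * π * I * ((((t : ZMod q).val : ℕ) : ℤ) : ℂ) / q) := by
    rw [Complex.exp_eq_exp_iff_exists_int]
    refine ⟨m, ?_⟩
    have ht : (t : ℂ) = ((((t : ZMod q).val : ℕ) : ℤ) : ℂ) + (q : ℂ) * (m : ℂ) := by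
      exact_mod_cast (show t = (((t : ZMod q).val : ℕ) : ℤ) + q * m by linear_combination hm)
    rw [ht]
    field_simp
  have h1 := I_mul_cot_eq_ratio q t
  have h2 := I_mul_cot_eq_ratio q ((((t : ZMod q).val : ℕ) : ℤ))
  rw [he] at h1
  push_cast at h1 h2
  exact mul_left_cancel₀ I_ne_zero (h1.trans h2.symm)

/-- `pp* ≡ 1 (mod q)` read in `ℤ/q`. [folklore] -/
private theorem cast_mul_cast_eq_one_odd {q : ℕ} {p u : ℤ} (hu : (q : ℤ) ∣ u * p - 1) :
    (u : ZMod q) * (p : ZMod q) = 1 := by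
  have h := (ZMod.intCast_zmod_eq_zero_iff_dvd (u * p - 1) q).mpr hu
  push_cast at h
  exact sub_eq_zero.mp h

/-- A number prime to `q ≥ 2` is not divisible by `q`. [folklore] -/
private theorem not_dvd_of_isCoprime {q : ℕ} (hq : 2 ≤ q) {t : ℤ} (ht : IsCoprime t q) : ¬ (q : ℤ) ∣ t := by
  rintro ⟨c, rfl⟩
  obtain ⟨a, b, hab⟩ := ht
  have : (q : ℤ) ∣ 1 := ⟨a * c + b, by linear_combination -hab⟩
  have := Int.le_of_dvd one_pos this
  omega

/-- **COROLLARY 4.5 in coprimality form**: for isospectral `L(q; 1, p₁)`, `L(q; 1, p₂)` with `q` odd and `pᵢpᵢ* ≡ 1`, if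
`p₁ + 1` and `p₁ − 1` are prime to `q` then so is `p₂ + s` for `s = ±1` (a common divisor `d > 1` of `p₂ + s` and `q` is
odd, and by Lemma 4.4 (divisor form, row g45-#3) it divides `p₁ + 1` or `p₁ − 1`). [cite: IkedaYamamoto1979, Corollary 4.5,
Lemma 4.4] -/
theorem isCoprime_of_lensMultiplicity_eq_of_odd {q : ℕ} [NeZero q] (hq : Odd q) {p₁ u₁ p₂ u₂ : ℤ}
    (hu₁ : (q : ℤ) ∣ u₁ * p₁ - 1) (hu₂ : (q : ℤ) ∣ u₂ * p₂ - 1) (hc₁ : IsCoprime (p₁ + 1) q) (hc₂ : IsCoprime (p₁ - 1) q)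
    (h : ∀ n : ℕ, lensMultiplicity q 1 p₁ n = lensMultiplicity q 1 p₂ n) {s : ℤ} (hs : s = 1 ∨ s = -1) :
    IsCoprime (p₂ + s) q := by
  rw [Int.isCoprime_iff_gcd_eq_one]
  by_contra hne
  set d : ℕ := Int.gcd (p₂ + s) q with hd
  have hdp : (d : ℤ) ∣ p₂ + s := Int.gcd_dvd_left ..
  have hdq : (d : ℤ) ∣ (q : ℤ) := Int.gcd_dvd_right ..
  have hdq' : d ∣ q := by exact_mod_cast hdq
  have hd0 : d ≠ 0 := fun h0 ↦ NeZero.ne q (Nat.eq_zero_of_zero_dvd (h0 ▸ hdq'))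
  have hd2 : ¬ (d : ℤ) ∣ 2 := by
    intro h2
    have h2' : d ∣ 2 := by exact_mod_cast h2
    have hdle : d ≤ 2 := Nat.le_of_dvd two_pos h2'
    have hdodd : ¬ 2 ∣ d := fun h2d ↦ (Nat.not_even_iff_odd.mpr hq) (even_iff_two_dvd.mpr (h2d.trans hdq'))
    interval_cases d <;> simp_all
  -- Lemma 4.4 (divisor form) for the pair `(p₂, p₁)`
  have key := dvd_or_dvd_of_dvd_of_lensMultiplicity_eq hu₂ hu₁ (fun n ↦ (h n).symm) hdq hd2
    (by rcases hs with rfl | rfl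
        · exact Or.inl hdp
        · exact Or.inr (by rw [sub_eq_add_neg]; exact hdp))
  have hd1 : (d : ℤ) ∣ 1 := by
    rcases key with hk | hk
    · obtain ⟨a, b, hab⟩ := hc₁
      obtain ⟨c, hc⟩ := hk
      obtain ⟨e, he⟩ := hdq
      exact ⟨a * c + b * e, by rw [← hab, hc, he]; ring⟩
    · obtain ⟨a, b, hab⟩ := hc₂
      obtain ⟨c, hc⟩ := hk
      obtain ⟨e, he⟩ := hdq
      exact ⟨a * c + b * e, by rw [← hab, hc, he]; ring⟩
  have := Int.eq_one_of_dvd_one (by positivity) hd1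
  exact hne (by exact_mod_cast this)

/-- **MAIN THEOREM (Ikeda–Yamamoto 1979) for an odd order `q ≥ 3` in the generic case, normalized weights.** Let `q ≥ 3` be
odd, `p₁, p₂` prime to `q` with `(p₁ + 1, q) = (p₁ − 1, q) = 1`. If `L(q; 1, p₁)` and `L(q; 1, p₂)` are isospectral
(`dim E_{n(n+2)}` agree for all `n`) then `p₁ ≡ ±p₂` or `p₁p₂ ≡ ±1 (mod q)` — (4.1)/(4.2) of Proposition 4.1: the two lens
spaces are isometric ("In the case `(p₁ + 1, q) = (p₁ − 1, q) = 1`, we can prove in the same way as in 6": (4.18) with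
`k = 1`, Corollary 4.5, Lemma 5.3 for the modulus `q`, and the combinatorics of §6). [cite: IkedaYamamoto1979, Main Theorem,
§7 (first case), §6, Corollary 4.5, Lemma 5.3, Proposition 4.1] -/
theorem dvd_of_lensMultiplicity_one_eq_of_odd {q : ℕ} [NeZero q] (hq : Odd q) (hq3 : 3 ≤ q) {p₁ p₂ : ℤ}
    (hp₁ : IsCoprime p₁ q) (hp₂ : IsCoprime p₂ q) (hc₁ : IsCoprime (p₁ + 1) q) (hc₂ : IsCoprime (p₁ - 1) q)
    (h : ∀ n : ℕ, lensMultiplicity q 1 p₁ n = lensMultiplicity q 1 p₂ n) :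
    (q : ℤ) ∣ p₁ - p₂ ∨ (q : ℤ) ∣ p₁ + p₂ ∨ (q : ℤ) ∣ p₁ * p₂ - 1 ∨ (q : ℤ) ∣ p₁ * p₂ + 1 := by
  haveI : Nontrivial (ZMod q) := ZMod.nontrivial_iff.mpr (by omega)
  obtain ⟨u₁, b₁, hub₁⟩ := hp₁
  obtain ⟨u₂, b₂, hub₂⟩ := hp₂
  have hu₁ : (q : ℤ) ∣ u₁ * p₁ - 1 := ⟨-b₁, by linear_combination hub₁⟩
  have hu₂ : (q : ℤ) ∣ u₂ * p₂ - 1 := ⟨-b₂, by linear_combination hub₂⟩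
  -- Corollary 4.5: `p₂ ± 1` are prime to `q` as well
  have hd₁ := isCoprime_of_lensMultiplicity_eq_of_odd hq hu₁ hu₂ hc₁ hc₂ h (s := 1) (Or.inl rfl)
  have hd₂ := isCoprime_of_lensMultiplicity_eq_of_odd hq hu₁ hu₂ hc₁ hc₂ h (s := -1) (Or.inr rfl)
  rw [← sub_eq_add_neg] at hd₂
  -- (4.18) with `k = 1`
  have h2 : ¬ (q : ℤ) ∣ 2 * 1 := by
    intro hd
    have := Int.le_of_dvd (by norm_num) hd
    have : (3 : ℤ) ≤ q := by exact_mod_cast hq3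
    omega
  have hrel := cot_alternatingSum_eq_of_lensMultiplicity_eq (k := 1) hu₁ hu₂ h2
    (by rw [one_mul]; exact not_dvd_of_isCoprime (by omega) hc₂) (by rw [one_mul]; exact not_dvd_of_isCoprime (by omega) hc₁)
    (by rw [one_mul]; exact not_dvd_of_isCoprime (by omega) hd₂) (by rw [one_mul]; exact not_dvd_of_isCoprime (by omega) hd₁) h
  simp only [cot_intCast_eq_cot_val'' (q := q)] at hrel
  have c1 : ((1 * (p₁ + 1) : ℤ) : ZMod q) = (p₁ : ZMod q) + 1 := by push_cast; ring
  have c2 : ((1 * (p₁ - 1) : ℤ) : ZMod q) = (p₁ : ZMod q) - 1 := by push_cast; ring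
  have c3 : ((1 * (u₁ + 1) : ℤ) : ZMod q) = (u₁ : ZMod q) + 1 := by push_cast; ring
  have c4 : ((1 * (u₁ - 1) : ℤ) : ZMod q) = (u₁ : ZMod q) - 1 := by push_cast; ring
  have c5 : ((1 * (p₂ + 1) : ℤ) : ZMod q) = (p₂ : ZMod q) + 1 := by push_cast; ring
  have c6 : ((1 * (p₂ - 1) : ℤ) : ZMod q) = (p₂ : ZMod q) - 1 := by push_cast; ring
  have c7 : ((1 * (u₂ + 1) : ℤ) : ZMod q) = (u₂ : ZMod q) + 1 := by push_cast; ring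
  have c8 : ((1 * (u₂ - 1) : ℤ) : ZMod q) = (u₂ : ZMod q) - 1 := by push_cast; ring
  rw [c1, c2, c3, c4, c5, c6, c7, c8] at hrel
  -- the hypotheses of the combinatorial core in `ℤ/q`
  have hUP := cast_mul_cast_eq_one_odd hu₁
  have hVQ := cast_mul_cast_eq_one_odd hu₂
  have unit_of : ∀ {t : ℤ}, IsCoprime t q → IsUnit (t : ZMod q) := fun ht ↦
    (ZMod.coe_int_isUnit_iff_isCoprime _ _).mpr ht.symm
  have hP1 : IsUnit ((p₁ : ZMod q) + 1) := by have := unit_of hc₁; push_cast at this; exact this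
  have hP2 : IsUnit ((p₁ : ZMod q) - 1) := by have := unit_of hc₂; push_cast at this; exact this
  have hQ1 : IsUnit ((p₂ : ZMod q) + 1) := by have := unit_of hd₁; push_cast at this; exact this
  have hQ2 : IsUnit ((p₂ : ZMod q) - 1) := by have := unit_of hd₂; push_cast at this; exact this
  have hU : IsUnit (u₁ : ZMod q) := IsUnit.of_mul_eq_one _ hUP
  have hV : IsUnit (u₂ : ZMod q) := IsUnit.of_mul_eq_one _ hVQ
  have hU1 : IsUnit ((u₁ : ZMod q) + 1) := by
    rw [show (u₁ : ZMod q) + 1 = (u₁ : ZMod q) * ((p₁ : ZMod q) + 1) by linear_combination -hUP]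
    exact hU.mul hP1
  have hU2 : IsUnit ((u₁ : ZMod q) - 1) := by
    rw [show (u₁ : ZMod q) - 1 = -((u₁ : ZMod q) * ((p₁ : ZMod q) - 1)) by linear_combination hUP]
    exact (hU.mul hP2).neg
  have hV1 : IsUnit ((u₂ : ZMod q) + 1) := by
    rw [show (u₂ : ZMod q) + 1 = (u₂ : ZMod q) * ((p₂ : ZMod q) + 1) by linear_combination -hVQ]
    exact hV.mul hQ1
  have hV2 : IsUnit ((u₂ : ZMod q) - 1) := by
    rw [show (u₂ : ZMod q) - 1 = -((u₂ : ZMod q) * ((p₂ : ZMod q) - 1)) by linear_combination hVQ]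
    exact (hV.mul hQ2).neg
  have hP0 : (p₁ : ZMod q) ≠ 0 := fun h0 ↦ by rw [h0, mul_zero] at hUP; exact zero_ne_one hUP
  have hU0 : (u₁ : ZMod q) ≠ 0 := fun h0 ↦ by rw [h0, zero_mul] at hUP; exact zero_ne_one hUP
  have hQ0 : (p₂ : ZMod q) ≠ 0 := fun h0 ↦ by rw [h0, mul_zero] at hVQ; exact zero_ne_one hVQ
  have hV0 : (u₂ : ZMod q) ≠ 0 := fun h0 ↦ by rw [h0, zero_mul] at hVQ; exact zero_ne_one hVQ
  have h2u : IsUnit (2 : ZMod q) := by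
    have := (ZMod.isUnit_iff_coprime 2 q).mpr (Nat.coprime_two_left.mpr hq)
    exact_mod_cast this
  have key := eq_or_eq_neg_of_cot_relation (by omega) h2u hP0 hU0 hQ0 hV0 hP1 hP2 hU1 hU2 hQ1 hQ2 hV1 hV2 hrel
  rcases key with e | e | e | e
  · refine Or.inl ((ZMod.intCast_zmod_eq_zero_iff_dvd _ _).mp ?_)
    push_cast; rw [e]; ring
  · refine Or.inr (Or.inl ((ZMod.intCast_zmod_eq_zero_iff_dvd _ _).mp ?_))
    push_cast; rw [e]; ring
  · refine Or.inr (Or.inr (Or.inl ((ZMod.intCast_zmod_eq_zero_iff_dvd _ _).mp ?_)))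
    push_cast; rw [e]; linear_combination hUP
  · refine Or.inr (Or.inr (Or.inr ((ZMod.intCast_zmod_eq_zero_iff_dvd _ _).mp ?_)))
    push_cast; rw [e]; linear_combination -hUP

/-! ### §2 General weights: `L(q; p₁, p₂)` with `(p₁ ± p₂, q) = 1` -/

/-- **MAIN THEOREM for an odd order `q ≥ 3`, general weights in the generic case.** Let `q ≥ 3` be odd and let
`L(q; p₁, p₂)` be a lens space with `(p₁ + p₂, q) = (p₁ − p₂, q) = 1` (equivalently `L(q; p₁, p₂) ≅ L(q; 1, p)`,
`p = p₁*p₂`, with `(p ± 1, q) = 1`). If `L(q; p₁', p₂')` is isospectral to it, then `p₁p₂' ≡ ±p₁'p₂` or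
`p₁p₁' ≡ ±p₂p₂' (mod q)`: the two spaces are isometric (Proposition 1.1). [cite: IkedaYamamoto1979, Main Theorem, §7 (first
case), §4 ("we may assume `p₀ = 1`"), Proposition 1.1] -/
theorem dvd_of_lensMultiplicity_eq_of_odd {q : ℕ} [NeZero q] (hq : Odd q) (hq3 : 3 ≤ q) {p₁ p₂ p₁' p₂' : ℤ}
    (hp₁ : IsCoprime p₁ q) (hp₂ : IsCoprime p₂ q) (hp₁' : IsCoprime p₁' q) (hp₂' : IsCoprime p₂' q)
    (hs : IsCoprime (p₁ + p₂) q) (hd : IsCoprime (p₁ - p₂) q)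
    (h : ∀ n : ℕ, lensMultiplicity q p₁ p₂ n = lensMultiplicity q p₁' p₂' n) :
    (q : ℤ) ∣ p₁ * p₂' - p₁' * p₂ ∨ (q : ℤ) ∣ p₁ * p₂' + p₁' * p₂ ∨
      (q : ℤ) ∣ p₁ * p₁' - p₂ * p₂' ∨ (q : ℤ) ∣ p₁ * p₁' + p₂ * p₂' := by
  obtain ⟨u₁, b₁, hub₁⟩ := hp₁
  obtain ⟨u₁', b₁', hub₁'⟩ := hp₁'
  have hu₁ : (q : ℤ) ∣ u₁ * p₁ - 1 := ⟨-b₁, by linear_combination hub₁⟩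
  have hu₁' : (q : ℤ) ∣ u₁' * p₁' - 1 := ⟨-b₁', by linear_combination hub₁'⟩
  have hcu₁ : IsCoprime u₁ q := ⟨p₁, b₁, by linear_combination hub₁⟩
  have hcu₁' : IsCoprime u₁' q := ⟨p₁', b₁', by linear_combination hub₁'⟩
  have hred : ∀ n : ℕ, lensMultiplicity q 1 (u₁ * p₂) n = lensMultiplicity q 1 (u₁' * p₂') n := fun n ↦ by
    rw [← lensMultiplicity_eq_one_left q hu₁ p₂ n, h n, lensMultiplicity_eq_one_left q hu₁' p₂' n]
  -- `u₁p₂ ± 1 ≡ u₁(p₂ ± p₁)` are prime to `q`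
  have hcp : IsCoprime (u₁ * p₂ + 1) q := by
    have e : u₁ * p₂ + 1 = u₁ * (p₁ + p₂) + (q : ℤ) * b₁ := by linear_combination -hub₁
    rw [e]
    exact (IsCoprime.mul_left hcu₁ hs).add_mul_left_left _
  have hcm : IsCoprime (u₁ * p₂ - 1) q := by
    have e : u₁ * p₂ - 1 = -(u₁ * (p₁ - p₂)) + (q : ℤ) * (-b₁) := by linear_combination hub₁
    rw [e]
    exact (IsCoprime.mul_left hcu₁ hd).neg_left.add_mul_left_left _
  have key := dvd_of_lensMultiplicity_one_eq_of_odd hq hq3 (hcu₁.mul_left hp₂) (hcu₁'.mul_left hp₂') hcp hcm hred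
  have eU := cast_mul_cast_eq_one_odd hu₁
  have eU' := cast_mul_cast_eq_one_odd hu₁'
  have cast0 : ∀ {t : ℤ}, (q : ℤ) ∣ t → (t : ZMod q) = 0 := fun ht ↦ (ZMod.intCast_zmod_eq_zero_iff_dvd _ _).mpr ht
  rcases key with e | e | e | e
  · have e' := cast0 e
    push_cast at e'
    refine Or.inl ((ZMod.intCast_zmod_eq_zero_iff_dvd _ _).mp ?_)
    push_cast
    linear_combination (-((p₁ : ZMod q) * (p₁' : ZMod q))) * e' + ((p₁' : ZMod q) * (p₂ : ZMod q)) * eU -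
      ((p₁ : ZMod q) * (p₂' : ZMod q)) * eU'
  · have e' := cast0 e
    push_cast at e'
    refine Or.inr (Or.inl ((ZMod.intCast_zmod_eq_zero_iff_dvd _ _).mp ?_))
    push_cast
    linear_combination ((p₁ : ZMod q) * (p₁' : ZMod q)) * e' - ((p₁' : ZMod q) * (p₂ : ZMod q)) * eU -
      ((p₁ : ZMod q) * (p₂' : ZMod q)) * eU'
  · have e' := cast0 e
    push_cast at e'
    refine Or.inr (Or.inr (Or.inl ((ZMod.intCast_zmod_eq_zero_iff_dvd _ _).mp ?_)))
    push_cast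
    linear_combination (-((p₁ : ZMod q) * (p₁' : ZMod q))) * e' +
      ((p₂ : ZMod q) * (p₂' : ZMod q) * (u₁' : ZMod q) * (p₁' : ZMod q)) * eU + ((p₂ : ZMod q) * (p₂' : ZMod q)) * eU'
  · have e' := cast0 e
    push_cast at e'
    refine Or.inr (Or.inr (Or.inr ((ZMod.intCast_zmod_eq_zero_iff_dvd _ _).mp ?_)))
    push_cast
    linear_combination ((p₁ : ZMod q) * (p₁' : ZMod q)) * e' -
      ((p₂ : ZMod q) * (p₂' : ZMod q) * (u₁' : ZMod q) * (p₁' : ZMod q)) * eU - ((p₂ : ZMod q) * (p₂' : ZMod q)) * eU'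

/-- **ISOSPECTRAL ⟹ ISOMETRIC for three-dimensional lens spaces with fundamental group of odd order `q ≥ 3`, in the generic
case `(p₁ ± p₂, q) = 1`** (Ikeda's criterion `LensWeightsEquivalent`; the converse, isometric ⟹ isospectral, is the tree's
`LensWeightsEquivalent.lensSpaceMultiplicity_eq`). [cite: IkedaYamamoto1979, Main Theorem, §7 (first case), Proposition 1.1]
[cite: Ikeda1980, Theorem 2.1] -/
theorem lensWeightsEquivalent_of_lensMultiplicity_eq_of_odd {q : ℕ} [NeZero q] (hq : Odd q) (hq3 : 3 ≤ q)
    {p₁ p₂ p₁' p₂' : ℤ} (hp₁ : IsCoprime p₁ q) (hp₂ : IsCoprime p₂ q) (hp₁' : IsCoprime p₁' q) (hp₂' : IsCoprime p₂' q)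
    (hs : IsCoprime (p₁ + p₂) q) (hd : IsCoprime (p₁ - p₂) q)
    (h : ∀ n : ℕ, lensMultiplicity q p₁ p₂ n = lensMultiplicity q p₁' p₂' n) :
    LensWeightsEquivalent q ![p₁, p₂] ![p₁', p₂'] :=
  (lensWeightsEquivalent_two_iff hp₁').mpr (dvd_of_lensMultiplicity_eq_of_odd hq hq3 hp₁ hp₂ hp₁' hp₂' hs hd h)

end Literature.Analysis.InnerProduct
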